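import Literature.MathematicalPhysics.QuantumFieldTheory.PlaqSystemClusterExpansion
import Literature.MathematicalPhysics.QuantumFieldTheory.StrongCouplingTorusLimit
import HarnessLib

/-!
# Local isomorphisms of plaquette systems: transport of activities, polymers and clusters

Two abstract plaquette systems `S : PlaqSystem d G ι`, `S' : PlaqSystem d G ι'` on the same Haar
product `ν = zdHaar d G` (`StrongCouplingPolymerSystem`) are **locally isomorphic along a
relabelling** `φ : ι → ι'` **on a label set** `A` when there is a relabelling of bonds
`g : ZdEdge d → ZdEdge d`, injective on the bonds of `A`, with
`S'.bonds (φ p) = g '' S.bonds p` and `S'.cost (φ p) U = S.cost p (U ∘ g)` for `p ∈ A`, and `φ` is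
injective on `A` (hypotheses `h1`–`h4` below; examples: the translations of a periodic box, the
inclusion of the non-wrapping part of a periodic box into a larger box, the covering projection
`torusProj` of `StrongCouplingTorusSystem` on a ball). Then everything the strong-coupling cluster
expansion sees is transported along `φ` on `A`:

* `PlaqSystem.adj_map_iff`, `PlaqSystem.isRConnected_image_iff`, `PlaqSystem.geomInc_image_iff`:
  adjacency, connectedness of label sets, the geometric incompatibility of polymers;
* `PlaqSystem.zPol_image_eq` (relabelling invariance of `ν`, the tree's
  `integral_comp_eq_of_dependsOn_injOn`), `PlaqSystem.connActivity_image_eq`: the activities;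
* `PlaqSystem.truncatedWeight_image_image_eq` (the tree's `truncatedWeight_image`),
  `PlaqSystem.isPolymerCluster_image_iff`, `PlaqSystem.sum_card_image_image`: the truncated
  functional `Φ^T`, the cluster property and the total size of a family of polymers supported in `A`.

Pure bookkeeping; everything is proved; no definitions (the hypotheses are passed explicitly).

## References

* E. Seiler, LNP 159 (1982), Ch. 2 (symmetries and boundary conditions of lattice gauge theories).
  [SeilerLNP1982]
* R. Kotecký, D. Preiss, Comm. Math. Phys. 103 (1986) 491–498, §2. [KoteckyPreiss1986]
-/

noncomputable section

open MeasureTheory Finset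
open Literature.Probability.LatticeModels

namespace Literature.MathematicalPhysics.QuantumFieldTheory

/-! ### Transport of chains along a relabelling -/

/-- Chains inside `X` for `R` map to chains inside `X.image φ` for `R'` when `φ` is a homomorphism
on `X`. [folklore] -/
theorem reflTransGen_image_of_hom {α α' : Type*} [DecidableEq α'] {R : α → α → Prop}
    {R' : α' → α' → Prop} {φ : α → α'} {X : Finset α}
    (hR : ∀ a ∈ X, ∀ b ∈ X, R a b → R' (φ a) (φ b)) {v w : α}
    (h : Relation.ReflTransGen (fun x y => R x y ∧ x ∈ X ∧ y ∈ X) v w) :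
    Relation.ReflTransGen (fun x y => R' x y ∧ x ∈ X.image φ ∧ y ∈ X.image φ) (φ v) (φ w) := by
  induction h with
  | refl => exact Relation.ReflTransGen.refl
  | tail _ hbc ih =>
    exact ih.tail ⟨hR _ hbc.2.1 _ hbc.2.2 hbc.1, Finset.mem_image_of_mem φ hbc.2.1,
      Finset.mem_image_of_mem φ hbc.2.2⟩

/-- Chains inside `X.image φ` between images lift to chains inside `X` when `φ` is injective on `X`
and reflects the relation on `X`. [folklore] -/
theorem reflTransGen_of_image {α α' : Type*} [DecidableEq α'] {R : α → α → Prop}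
    {R' : α' → α' → Prop} {φ : α → α'} {X : Finset α} (hφ : Set.InjOn φ X)
    (hR : ∀ a ∈ X, ∀ b ∈ X, R' (φ a) (φ b) → R a b) {v w : α} (hv : v ∈ X) (hw : w ∈ X)
    (h : Relation.ReflTransGen (fun x y => R' x y ∧ x ∈ X.image φ ∧ y ∈ X.image φ) (φ v) (φ w)) :
    Relation.ReflTransGen (fun x y => R x y ∧ x ∈ X ∧ y ∈ X) v w := by
  -- induction with the motive "every preimage in `X` of the endpoint is reachable from `v`"
  have key : ∀ w', Relation.ReflTransGen (fun x y => R' x y ∧ x ∈ X.image φ ∧ y ∈ X.image φ) (φ v) w' →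
      ∀ u ∈ X, φ u = w' → Relation.ReflTransGen (fun x y => R x y ∧ x ∈ X ∧ y ∈ X) v u := by
    intro w' hw'
    induction hw' with
    | refl =>
      intro u hu huv
      rw [hφ hu hv huv]
    | @tail b c _ hbc ih =>
      intro u hu huc
      obtain ⟨b₀, hb₀, rfl⟩ := Finset.mem_image.1 hbc.2.1
      have hstep : R b₀ u := hR b₀ hb₀ u hu (huc ▸ hbc.1)
      exact (ih b₀ hb₀ rfl).tail ⟨hstep, hb₀, hu⟩
  exact key (φ w) h w hw rfl

/-- **Connectedness is transported**: for `φ` injective on `X` and respecting the relation on `X`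
in both directions, `X.image φ` is `R'`-connected iff `X` is `R`-connected. [folklore] -/
theorem isRConnected_image_iff_of_injOn {α α' : Type*} [DecidableEq α] [DecidableEq α']
    {R : α → α → Prop} {R' : α' → α' → Prop} {φ : α → α'} {X : Finset α} (hφ : Set.InjOn φ X)
    (hR : ∀ a ∈ X, ∀ b ∈ X, (R' (φ a) (φ b) ↔ R a b)) :
    IsRConnected R' (X.image φ) ↔ IsRConnected R X := by
  constructor
  · rintro ⟨hne, hc⟩
    refine ⟨?_, fun v hv w hw => ?_⟩
    · obtain ⟨x', hx'⟩ := hne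
      obtain ⟨x, hx, -⟩ := Finset.mem_image.1 hx'
      exact ⟨x, hx⟩
    · exact reflTransGen_of_image hφ (fun a ha b hb h => (hR a ha b hb).1 h) hv hw
        (hc _ (Finset.mem_image_of_mem φ hv) _ (Finset.mem_image_of_mem φ hw))
  · rintro ⟨hne, hc⟩
    refine ⟨hne.image φ, fun v' hv' w' hw' => ?_⟩
    obtain ⟨v, hv, rfl⟩ := Finset.mem_image.1 hv'
    obtain ⟨w, hw, rfl⟩ := Finset.mem_image.1 hw'
    exact reflTransGen_image_of_hom (fun a ha b hb h => (hR a ha b hb).2 h) (hc v hv w hw)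

/-- **The cluster property is transported** along a relabelling of polymers that is injective on the
family and respects incompatibility on it. [folklore] -/
theorem isPolymerCluster_image_iff_of_injOn {P P' : Type*} [DecidableEq P] [DecidableEq P']
    {inc : P → P → Prop} {inc' : P' → P' → Prop} {Ψ : P → P'} {C : Finset P} (hΨ : Set.InjOn Ψ C)
    (hinc : ∀ a ∈ C, ∀ b ∈ C, (inc' (Ψ a) (Ψ b) ↔ inc a b)) :
    IsPolymerCluster inc' (C.image Ψ) ↔ IsPolymerCluster inc C := by
  constructor
  · intro h C₁ hC₁ hne₁ hne₂
    have hsd : (C.image Ψ) \ (C₁.image Ψ) = (C \ C₁).image Ψ := (Finset.image_sdiff_of_injOn hΨ hC₁).symm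
    obtain ⟨γ₁', hγ₁', γ₂', hγ₂', hinc'⟩ := h (C₁.image Ψ) (Finset.image_subset_image hC₁) (hne₁.image Ψ)
      (by rw [hsd]; exact hne₂.image Ψ)
    rw [hsd] at hγ₂'
    obtain ⟨γ₁, hγ₁, rfl⟩ := Finset.mem_image.1 hγ₁'
    obtain ⟨γ₂, hγ₂, rfl⟩ := Finset.mem_image.1 hγ₂'
    exact ⟨γ₁, hγ₁, γ₂, hγ₂, (hinc γ₁ (hC₁ hγ₁) γ₂ (Finset.mem_sdiff.1 hγ₂).1).1 hinc'⟩
  · intro h C₁' hC₁' hne₁ hne₂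
    obtain ⟨C₁, hC₁, rfl⟩ := Finset.subset_image_iff.1 hC₁'
    have hsd : (C.image Ψ) \ (C₁.image Ψ) = (C \ C₁).image Ψ := (Finset.image_sdiff_of_injOn hΨ hC₁).symm
    have hne₁' : C₁.Nonempty := by
      obtain ⟨x', hx'⟩ := hne₁
      obtain ⟨x, hx, -⟩ := Finset.mem_image.1 hx'
      exact ⟨x, hx⟩
    have hne₂' : (C \ C₁).Nonempty := by
      rw [hsd] at hne₂
      obtain ⟨x', hx'⟩ := hne₂
      obtain ⟨x, hx, -⟩ := Finset.mem_image.1 hx'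
      exact ⟨x, hx⟩
    obtain ⟨γ₁, hγ₁, γ₂, hγ₂, hi⟩ := h C₁ hC₁ hne₁' hne₂'
    refine ⟨Ψ γ₁, Finset.mem_image_of_mem Ψ hγ₁, Ψ γ₂, ?_, (hinc γ₁ (hC₁ hγ₁) γ₂ (Finset.mem_sdiff.1 hγ₂).1).2 hi⟩
    rw [hsd]
    exact Finset.mem_image_of_mem Ψ hγ₂

namespace PlaqSystem

variable {d : ℕ} {G : Type*} {ι ι' : Type*} {S : PlaqSystem d G ι} {S' : PlaqSystem d G ι'}
  [DecidableEq ι] [DecidableEq ι'] {φ : ι → ι'} {g : ZdEdge d → ZdEdge d} {A : Finset ι}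

/-! ### Bonds, adjacency, polymers -/

/-- Disjointness of images under a map injective on the union. [folklore] -/
theorem disjoint_image_iff_of_injOn {α β : Type*} [DecidableEq α] [DecidableEq β] {f : α → β}
    {s t : Finset α} (hf : Set.InjOn f (↑(s ∪ t) : Set α)) :
    Disjoint (s.image f) (t.image f) ↔ Disjoint s t := by
  constructor
  · intro h
    exact Finset.disjoint_left.2 fun a has hat =>
      Finset.disjoint_left.1 h (Finset.mem_image_of_mem f has) (Finset.mem_image_of_mem f hat)
  · intro h
    refine Finset.disjoint_left.2 fun b hbs hbt => ?_
    obtain ⟨a, has, rfl⟩ := Finset.mem_image.1 hbs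
    obtain ⟨a', hat, haa'⟩ := Finset.mem_image.1 hbt
    have : a' = a := hf (by simp [hat]) (by simp [has]) haa'
    subst this
    exact Finset.disjoint_left.1 h has hat

omit [DecidableEq ι] [DecidableEq ι'] in
/-- **Adjacency is transported**: for `p, q ∈ A`, `φ p` and `φ q` share a bond of `S'` iff `p` and
`q` share a bond of `S`. [folklore] -/
theorem adj_map_iff (h1 : ∀ p ∈ A, S'.bonds (φ p) = (S.bonds p).image g)
    (h2 : Set.InjOn g (↑(A.biUnion S.bonds) : Set (ZdEdge d))) {p q : ι} (hp : p ∈ A) (hq : q ∈ A) :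
    S'.Adj (φ p) (φ q) ↔ S.Adj p q := by
  unfold PlaqSystem.Adj
  rw [h1 p hp, h1 q hq, disjoint_image_iff_of_injOn]
  exact h2.mono (by
    intro e he
    simp only [Finset.coe_union, Set.mem_union, Finset.mem_coe] at he
    rcases he with he | he
    · exact Finset.mem_biUnion.2 ⟨p, hp, he⟩
    · exact Finset.mem_biUnion.2 ⟨q, hq, he⟩)

/-- **Connectedness of label sets is transported** on `A`. [folklore] -/
theorem isRConnected_image_iff (h1 : ∀ p ∈ A, S'.bonds (φ p) = (S.bonds p).image g)
    (h2 : Set.InjOn g (↑(A.biUnion S.bonds) : Set (ZdEdge d))) (h4 : Set.InjOn φ A) {Y : Finset ι}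
    (hY : Y ⊆ A) : IsRConnected S'.Adj (Y.image φ) ↔ IsRConnected S.Adj Y :=
  isRConnected_image_iff_of_injOn (h4.mono (Finset.coe_subset.2 hY))
    fun _ ha _ hb => adj_map_iff h1 h2 (hY ha) (hY hb)

/-- **The geometric incompatibility of polymers is transported** on `A`. [folklore] -/
theorem geomInc_image_iff (h1 : ∀ p ∈ A, S'.bonds (φ p) = (S.bonds p).image g)
    (h2 : Set.InjOn g (↑(A.biUnion S.bonds) : Set (ZdEdge d))) (h4 : Set.InjOn φ A) {Y Y' : Finset ι}
    (hY : Y ⊆ A) (hY' : Y' ⊆ A) :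
    GeomInc S'.Adj (Y.image φ) (Y'.image φ) ↔ GeomInc S.Adj Y Y' := by
  have hinj : Set.InjOn (Finset.image φ) (↑({Y, Y'} : Finset (Finset ι)) : Set (Finset ι)) :=
    injOn_image_of_injOn h4 (by
      intro X hX
      simp only [Finset.mem_insert, Finset.mem_singleton] at hX
      rcases hX with rfl | rfl <;> assumption)
  unfold GeomInc _root_.Literature.Probability.LatticeModels.Touches
  constructor
  · rintro (h | ⟨w', hw', q', hq', h⟩)
    · exact Or.inl (hinj (by simp) (by simp) h)
    · obtain ⟨w, hw, rfl⟩ := Finset.mem_image.1 hw'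
      obtain ⟨q, hq, rfl⟩ := Finset.mem_image.1 hq'
      refine Or.inr ⟨w, hw, q, hq, ?_⟩
      rcases h with h | h
      · exact Or.inl (h4 (hY hw) (hY' hq) h)
      · exact Or.inr ((adj_map_iff h1 h2 (hY hw) (hY' hq)).1 h)
  · rintro (rfl | ⟨w, hw, q, hq, h⟩)
    · exact Or.inl rfl
    · refine Or.inr ⟨φ w, Finset.mem_image_of_mem φ hw, φ q, Finset.mem_image_of_mem φ hq, ?_⟩
      rcases h with rfl | h
      · exact Or.inl rfl
      · exact Or.inr ((adj_map_iff h1 h2 (hY hw) (hY' hq)).2 h)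

/-! ### Activities -/

section Activities

variable [Group G] [TopologicalSpace G] [IsTopologicalGroup G] [CompactSpace G] [MeasurableSpace G]
  [BorelSpace G] {M : ℝ} {D : ℕ}

omit [DecidableEq ι] [DecidableEq ι'] [Group G] [TopologicalSpace G] [IsTopologicalGroup G]
  [CompactSpace G] [MeasurableSpace G] [BorelSpace G] in
/-- The weights are transported: `f'_{φ p}(U) = f_p(U ∘ g)`. [folklore] -/
theorem weight_map_eq (h3 : ∀ p ∈ A, ∀ U : ZdGaugeConfig d G, S'.cost (φ p) U = S.cost p (U ∘ g))
    {p : ι} (hp : p ∈ A) (β : ℂ) (U : ZdGaugeConfig d G) :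
    S'.weight β (φ p) U = S.weight β p (U ∘ g) := by
  simp only [PlaqSystem.weight, h3 p hp U]

/-- **The polymer activities are transported**: `z'(φ Y) = z(Y)` for `Y ⊆ A` (relabelling invariance
of the Haar product). [cite: SeilerLNP1982, Ch. 2] -/
theorem zPol_image_eq (hR : S.Regular M D) (h2 : Set.InjOn g (↑(A.biUnion S.bonds) : Set (ZdEdge d)))
    (h3 : ∀ p ∈ A, ∀ U : ZdGaugeConfig d G, S'.cost (φ p) U = S.cost p (U ∘ g)) (h4 : Set.InjOn φ A)
    {Y : Finset ι} (hY : Y ⊆ A) (β : ℂ) : S'.zPol (Y.image φ) β = S.zPol Y β := by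
  rw [zPol_eq, zPol_eq]
  have hprod : ∀ U : ZdGaugeConfig d G, S'.weightProd β (Y.image φ) U = S.weightProd β Y (U ∘ g) := by
    intro U
    unfold weightProd
    rw [Finset.prod_image fun a ha b hb h => h4 (hY ha) (hY hb) h]
    exact Finset.prod_congr rfl fun p hp => weight_map_eq h3 (hY hp) β U
  simp_rw [hprod]
  exact integral_comp_eq_of_dependsOn_injOn (measurable_weightProd hR β Y) (S.dependsOn_weightProd β Y)
    (h2.mono (Finset.coe_subset.2 (Finset.biUnion_subset_biUnion_of_subset_left _ hY)))

/-- **The polymer functional is transported**: the `connActivity` of `S'` at `φ Y` is that of `S` at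
`Y`, for `Y ⊆ A`. [folklore] -/
theorem connActivity_image_eq (hR : S.Regular M D) (h1 : ∀ p ∈ A, S'.bonds (φ p) = (S.bonds p).image g)
    (h2 : Set.InjOn g (↑(A.biUnion S.bonds) : Set (ZdEdge d)))
    (h3 : ∀ p ∈ A, ∀ U : ZdGaugeConfig d G, S'.cost (φ p) U = S.cost p (U ∘ g)) (h4 : Set.InjOn φ A)
    {Y : Finset ι} (hY : Y ⊆ A) (β : ℂ) :
    connActivity S'.Adj (zdHaar d G) (S'.weight β) (Y.image φ) =
      connActivity S.Adj (zdHaar d G) (S.weight β) Y := by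
  by_cases hc : IsRConnected S.Adj Y
  · have hc' : IsRConnected S'.Adj (Y.image φ) := (isRConnected_image_iff h1 h2 h4 hY).2 hc
    simp only [connActivity, hc, hc', if_true, cellActivity_eq_zPol]
    exact zPol_image_eq hR h2 h3 h4 hY β
  · have hc' : ¬ IsRConnected S'.Adj (Y.image φ) := fun h => hc ((isRConnected_image_iff h1 h2 h4 hY).1 h)
    simp only [connActivity, hc, hc', if_false]

/-! ### Clusters -/

/-- **The truncated functional is transported**: for a finite family `𝒞` of polymers supported in
`A`, `Φ'^T(φ 𝒞) = Φ^T(𝒞)` (the tree's `truncatedWeight_image` with the polymer relabelling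
`Y ↦ φ Y`). [cite: KoteckyPreiss1986, §2] -/
theorem truncatedWeight_image_image_eq (hR : S.Regular M D)
    (h1 : ∀ p ∈ A, S'.bonds (φ p) = (S.bonds p).image g)
    (h2 : Set.InjOn g (↑(A.biUnion S.bonds) : Set (ZdEdge d)))
    (h3 : ∀ p ∈ A, ∀ U : ZdGaugeConfig d G, S'.cost (φ p) U = S.cost p (U ∘ g)) (h4 : Set.InjOn φ A)
    {𝒞 : Finset (Finset ι)} (h𝒞 : ∀ Y ∈ 𝒞, Y ⊆ A) (β : ℂ) :
    truncatedWeight (GeomInc S'.Adj) (connActivity S'.Adj (zdHaar d G) (S'.weight β))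
        (𝒞.image (Finset.image φ)) =
      truncatedWeight (GeomInc S.Adj) (connActivity S.Adj (zdHaar d G) (S.weight β)) 𝒞 :=
  truncatedWeight_image (injOn_image_of_injOn h4 h𝒞)
    (fun Y hY Y' hY' => geomInc_image_iff h1 h2 h4 (h𝒞 Y hY) (h𝒞 Y' hY'))
    fun Y hY => connActivity_image_eq hR h1 h2 h3 h4 (h𝒞 Y hY) β

end Activities

/-- **The cluster property is transported** for families supported in `A`. [folklore] -/
theorem isPolymerCluster_image_iff (h1 : ∀ p ∈ A, S'.bonds (φ p) = (S.bonds p).image g)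
    (h2 : Set.InjOn g (↑(A.biUnion S.bonds) : Set (ZdEdge d))) (h4 : Set.InjOn φ A)
    {𝒞 : Finset (Finset ι)} (h𝒞 : ∀ Y ∈ 𝒞, Y ⊆ A) :
    IsPolymerCluster (GeomInc S'.Adj) (𝒞.image (Finset.image φ)) ↔ IsPolymerCluster (GeomInc S.Adj) 𝒞 := by
  classical
  exact isPolymerCluster_image_iff_of_injOn (injOn_image_of_injOn h4 h𝒞)
    fun Y hY Y' hY' => geomInc_image_iff h1 h2 h4 (h𝒞 Y hY) (h𝒞 Y' hY')

omit [DecidableEq ι] in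
/-- **The total size of a family of polymers is transported.** [folklore] -/
theorem sum_card_image_image (h4 : Set.InjOn φ A) {𝒞 : Finset (Finset ι)} (h𝒞 : ∀ Y ∈ 𝒞, Y ⊆ A) :
    ∑ Y' ∈ 𝒞.image (Finset.image φ), (Y'.card : ℝ) = ∑ Y ∈ 𝒞, (Y.card : ℝ) := by
  classical
  rw [Finset.sum_image (injOn_image_of_injOn h4 h𝒞)]
  exact Finset.sum_congr rfl fun Y hY =>
    by rw [Finset.card_image_of_injOn (h4.mono (Finset.coe_subset.2 (h𝒞 Y hY)))]

omit [DecidableEq ι] in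
/-- The members of a transported family are the transported members: polymers of the image lie in
`φ '' A` and are connected iff their preimages are. [folklore] -/
theorem mem_rconnSubsets_image_iff (h1 : ∀ p ∈ A, S'.bonds (φ p) = (S.bonds p).image g)
    (h2 : Set.InjOn g (↑(A.biUnion S.bonds) : Set (ZdEdge d))) (h4 : Set.InjOn φ A)
    {Y : Finset ι} (hY : Y ⊆ A) {W' : Finset ι'} (hW' : A.image φ ⊆ W') :
    Y.image φ ∈ rconnSubsets S'.Adj W' ↔ IsRConnected S.Adj Y := by
  classical
  rw [mem_rconnSubsets, isRConnected_image_iff h1 h2 h4 hY]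
  exact ⟨fun h => h.2, fun h => ⟨(Finset.image_subset_image hY).trans hW', h⟩⟩

end PlaqSystem

end Literature.MathematicalPhysics.QuantumFieldTheory
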